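import Mathlib
import Summits.Ventures.PercRepro2.HCov
import Summits.Ventures.PercRepro2.GcSkelRules
import Summits.Ventures.PercRepro2.GcSkelReductionT
import Summits.Ventures.PercRepro2.GcSkelShapeT
import Summits.Ventures.PercRepro2.GcSkelReductionMin
import Summits.Ventures.PercRepro2.GcSkelShapeZ
import Summits.Ventures.PercRepro2.GcHatConn
import Summits.Ventures.PercRepro2.GcSkelReductionHat
import Summits.Ventures.PercRepro2.GcSkelShapeHat
import Summits.Ventures.PercRepro2.GcBundleConn
import Summits.Ventures.PercRepro2.GcBundle
import Summits.Ventures.PercRepro2.GcSkelReductionBundle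
import Summits.Ventures.PercRepro2.GcSkelShapeBundle
import Summits.Ventures.PercRepro2.GcSkelShapeBundlePair
import Summits.Ventures.PercRepro2.TypedUnmarkedCount

/-!
# The seven-vertex members of the class of record (blind cell PercRepro2, typer-1 g57)

The class of record `WReducedMinHAZB` has at least seven vertices (`shape_of_wredMinHAZB`: two
active unmarked vertices beside the five marks). **`seven_vertex_structure`** describes its
members on EXACTLY seven vertices — the smallest open instances of the weighted reduction lane —
in one statement: the vertices are the five marks and two unmarked vertices `x ≠ y`, both active
with at least three non-loop edges, each carrying non-loop edges to two distinct vertices outside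
the roots (`exists_two_nonroot_nbrs_of_wredMinHAZB`), and together reaching two distinct marks
among `{o, b, a₃}` (`exists_two_outer_nbrs_of_pair`); the rest of the shape
(`shape_of_wredMinHAZB`) applies verbatim. The unmarked vertices are counted through mine-2 g42's
`markSet` (`card_markSet_of_distinct`). Standard axioms.
-/

namespace Summit.Ventures.PercRepro2

open CovForm RECM CovForm.TypedRed

namespace WRed

section Seven

variable {V : Type*} {E : Type*} [Fintype V] [DecidableEq V] [Fintype E] [DecidableEq E]

omit [Fintype E] [DecidableEq E] in
/-- On seven vertices with five distinct marks, the unmarked vertices are exactly two given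
distinct unmarked vertices. -/
lemma unmarked_eq_of_card_seven {o a₁ a₂ a₃ b x y : V} (h12 : a₁ ≠ a₂) (h13 : a₁ ≠ a₃)
    (h23 : a₂ ≠ a₃) (ho1 : o ≠ a₁) (ho2 : o ≠ a₂) (ho3 : o ≠ a₃) (hob : o ≠ b) (hb1 : b ≠ a₁)
    (hb2 : b ≠ a₂) (hb3 : b ≠ a₃) (hV : Fintype.card V = 7) (hxy : x ≠ y)
    (hx : Unmarked o a₁ a₂ a₃ b x) (hy : Unmarked o a₁ a₂ a₃ b y) :
    ∀ u, Unmarked o a₁ a₂ a₃ b u → u = x ∨ u = y := by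
  -- the unmarked vertices form the complement of the five marks, of cardinality two
  have hmem : ∀ u, Unmarked o a₁ a₂ a₃ b u ↔ u ∈ Finset.univ \ markSet o a₁ a₂ a₃ b := by
    intro u
    simp only [Finset.mem_sdiff, Finset.mem_univ, true_and, mem_markSet, Unmarked, not_or]
  have hcard : (Finset.univ \ markSet o a₁ a₂ a₃ b).card = 2 := by
    rw [Finset.card_sdiff_of_subset (Finset.subset_univ _), Finset.card_univ, hV,
      card_markSet_of_distinct h12 h13 h23 ho1 ho2 ho3 hob hb1 hb2 hb3]
  have hsub : ({x, y} : Finset V) ⊆ Finset.univ \ markSet o a₁ a₂ a₃ b := by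
    intro u hu
    rw [Finset.mem_insert, Finset.mem_singleton] at hu
    rcases hu with rfl | rfl
    · exact (hmem u).1 hx
    · exact (hmem u).1 hy
  have heq : ({x, y} : Finset V) = Finset.univ \ markSet o a₁ a₂ a₃ b :=
    Finset.eq_of_subset_of_card_le hsub (by rw [hcard, Finset.card_pair hxy])
  intro u hu
  have : u ∈ ({x, y} : Finset V) := by rw [heq]; exact (hmem u).1 hu
  rw [Finset.mem_insert, Finset.mem_singleton] at this
  exact this

/-- **THE SEVEN-VERTEX MEMBERS OF THE CLASS OF RECORD, IN ONE STATEMENT**: beside the five marks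
exactly two unmarked vertices `x ≠ y`, both active with at least three non-loop edges, each with
non-loop edges to two distinct vertices outside the roots, and together reaching two distinct
vertices outside `{x, y, a₁, a₂}` (hence two of `{o, b, a₃}`). -/
theorem seven_vertex_structure {ends : E → Sym2 V} {o a₁ a₂ a₃ b : V}
    (h : WReducedMinHAZB ends o a₁ a₂ a₃ b)
    (h12 : a₁ ≠ a₂) (h13 : a₁ ≠ a₃) (h23 : a₂ ≠ a₃) (ho1 : o ≠ a₁) (ho2 : o ≠ a₂) (ho3 : o ≠ a₃)
    (hob : o ≠ b) (hb1 : b ≠ a₁) (hb2 : b ≠ a₂) (hb3 : b ≠ a₃) (hV : Fintype.card V = 7) :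
    ∃ x y : V, x ≠ y ∧ Unmarked o a₁ a₂ a₃ b x ∧ Unmarked o a₁ a₂ a₃ b y ∧
      (∀ u, Unmarked o a₁ a₂ a₃ b u → u = x ∨ u = y) ∧
      3 ≤ nonLoopDeg ends x ∧ 3 ≤ nonLoopDeg ends y ∧
      (∃ (e f : E) (z w : V), ends e = s(x, z) ∧ ends f = s(x, w) ∧ z ≠ w ∧ z ≠ x ∧ w ≠ x ∧
        z ≠ a₁ ∧ z ≠ a₂ ∧ w ≠ a₁ ∧ w ≠ a₂) ∧
      (∃ (e f : E) (z w : V), ends e = s(y, z) ∧ ends f = s(y, w) ∧ z ≠ w ∧ z ≠ y ∧ w ≠ y ∧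
        z ≠ a₁ ∧ z ≠ a₂ ∧ w ≠ a₁ ∧ w ≠ a₂) ∧
      (∃ (e f : E) (z w : V), (ends e = s(x, z) ∨ ends e = s(y, z)) ∧
        (ends f = s(x, w) ∨ ends f = s(y, w)) ∧ z ≠ w ∧
        z ≠ x ∧ z ≠ y ∧ z ≠ a₁ ∧ z ≠ a₂ ∧ w ≠ x ∧ w ≠ y ∧ w ≠ a₁ ∧ w ≠ a₂) := by
  have hs := shape_of_wredMinHAZH (wredMinHAZH_of_wredMinHAZB h) h12 h13 h23 ho1 ho2 ho3 hob hb1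
    hb2 hb3
  obtain ⟨x, y, hxy, hx, hy, hxa, hya⟩ := hs.1.2.2.2.2.2.2.2.2.2.2.2.2.1
  have hdeg : ∀ u, Unmarked o a₁ a₂ a₃ b u → (∃ e, u ∈ ends e ∧ ¬ (ends e).IsDiag) →
      3 ≤ nonLoopDeg ends u := by
    intro u hu hact
    rcases hs.1.2.1 u hu with h0 | h3
    · exfalso
      obtain ⟨e, hue, hd⟩ := hact
      have : e ∈ edgesAt ends u := mem_edgesAt.2 ⟨hue, hd⟩
      have : 0 < nonLoopDeg ends u := Finset.card_pos.2 ⟨e, this⟩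
      omega
    · exact h3
  refine ⟨x, y, hxy, hx, hy, unmarked_eq_of_card_seven h12 h13 h23 ho1 ho2 ho3 hob hb1 hb2 hb3 hV
    hxy hx hy, hdeg x hx hxa, hdeg y hy hya, ?_, ?_, ?_⟩
  · obtain ⟨e, f, z, w, he, hf, hzw, hzx, hwx, hz1, hz2, hw1, hw2⟩ :=
      exists_two_nonroot_nbrs_of_wredMinHAZB h h12 h13 h23 ho1 ho2 ho3 hob hb1 hb2 hb3 hx hxa
    exact ⟨e, f, z, w, he, hf, hzw, hzx, hwx, hz1, hz2, hw1, hw2⟩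
  · obtain ⟨e, f, z, w, he, hf, hzw, hzy, hwy, hz1, hz2, hw1, hw2⟩ :=
      exists_two_nonroot_nbrs_of_wredMinHAZB h h12 h13 h23 ho1 ho2 ho3 hob hb1 hb2 hb3 hy hya
    exact ⟨e, f, z, w, he, hf, hzw, hzy, hwy, hz1, hz2, hw1, hw2⟩
  · exact exists_two_outer_nbrs_of_pair h h12 h13 h23 ho1 ho2 ho3 hob hb1 hb2 hb3 hx hy hxy hxa

end Seven

end WRed

end Summit.Ventures.PercRepro2
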